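import Literature.Barriers.ValiantsHypothesis.BIJL18PerComplexityModP
import Literature.Barriers.ValiantsHypothesis.BIJL18Thm24Holds
import Literature.Computability.AlgebraicComplexity.HomogenisationFormalDegree
import Literature.Computability.AlgebraicComplexity.ZModCircuitIntegerCodes
import Literature.Computability.AlgebraicComplexity.CircuitCodeReading
import Literature.Computability.AlgebraicComplexity.ArithCircuitVarsCount
import Literature.Computability.AlgebraicComplexity.PermanentIrreducible
import HarnessLib

/-!
# Bläser–Ikenmeyer–Jindal–Lysikov 2018, Thm. 6: the honest witness circuits of the `∃·BPP`
# protocol exist and are short (composition of steps (c), B5, B6 of the route of record)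

Theorem-only companion of `BIJL18PermanentZero.lean` (val-lit cell, seat t19; brick «B9» of the
route of record to the LOAD-BEARING fact `BIJL2018_thm6`, memo `MEMO-p1g6-BIJL18-thm6-route.md`).
Source: [BlaserIkenmeyerJindalLysikov2018] §6, proof of Thm. 5 / Thm. 6 (ECCC TR18-064 pp. 18–19):
the `∃`-machine "guesses" for every `k ≤ n` a circuit for `per_k` over `𝔽_p`; such circuits EXIST
and have codes of polynomial length because (step 6, Thm. 24 = Kaltofen) `per_k` has small circuits
over `𝔽_p` whenever a small nonzero multiple of it does, and circuits over `𝔽_p` have constants of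
`log p` bits.

**What this file proves** (no definitions, no named facts). For a prime `p` and a level `n + 1`:

* `exists_witnessCircuit_of_complexity_le` — if `L_{𝔽_p}(Per_{n+1}) ≤ S` then there is an INTEGER
  circuit `C` over `(n+1)·(n+1)` variables (matrix entry `(a, b)` at `finProdFinEquiv (a, b)`),
  well formed, every gate of fan-in exactly two, formal degree `≤ n + 1`, constants in `[0, p)`,
  computing `Per_{n+1}` modulo `p` (`map (ℤ → 𝔽_p) C.eval = rename finProdFinEquiv Per_{n+1}`), of
  size `≤ (n+1)² S + (n+1)`, whose code word `circuitWord ((n+1)(n+1)) C` hosts its variables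
  (`(n+1)(n+1) ≤ |code|`, so the tree's reader `rdCircuit` decodes it exactly) and has length
  `≤ 26 · (3 · size + 1) · (size p + size size + size ((n+1)(n+1)) + 6)` — by the tree's
  homogenisation with formal degree (`ArithCircuit.exists_computes_formalDegree_le`, brick B5) and
  integer lift (`ArithCircuit.liftZMod`, brick B6);
* `intCast_eval_eq_permanent` — pointwise form: at an integer point `x`, `C(x) mod p` is the
  permanent of the matrix `(x (finProdFinEquiv (a,b)) mod p)_{a,b}` (what the verifier's modular
  evaluator is compared against); `eval_semPoly_circuitWord` — the same through the tree's
  junk-tolerant reading `CircuitCode.semPoly` of the code word;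
* `exists_witnessCircuits` — **from the typed hypothesis of Thm. 6** (`HasVP0NaturalProofsAgainstPerZero`)
  and Thm. 24 (now the tree's theorem `BIJL2018_thm24_holds`): for the natural-proof family `D`
  (`exists_complexity_perPoly_zmod_le`, step (c)) and ONE exponent `c`, for every prime `p` with
  `D_{n+1} mod p ≠ 0` and `deg D_{n+1} < p`, such a witness circuit exists with size and code
  length `≤ ((n + 2) · (log₂ p + 2))^c` — the polynomial witness-length bound of the `∃·BPP`
  protocol.

Honest framing: bookkeeping composition for the completeness half of a 2018 conditional barrier
theorem; `BIJL2018_thm6` itself is NOT discharged here (the verifier machine and the assembly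
remain); `VP ≠ VNP` is NOT proved and nothing here is progress on it.

## References

* [BlaserIkenmeyerJindalLysikov2018] M. Bläser, C. Ikenmeyer, G. Jindal, V. Lysikov, *Generalized
  matrix completion and algebraic natural proofs*, STOC 2018 / ECCC TR18-064, §6 (proof of Thm. 5,
  steps 1 and 6; Thm. 6; Thm. 24), pp. 18–19.
* [KabanetsImpagliazzo2004] V. Kabanets, R. Impagliazzo, Comput. Complexity 13 (2004), §2
  (circuits as strings).
* [BurgisserClausenShokrollahi1997] P. Bürgisser, M. Clausen, M. A. Shokrollahi, *Algebraic
  Complexity Theory*, Lemma (21.25) (homogenisation).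
-/

noncomputable section

namespace Literature.Barriers.ValiantsHypothesis

open MvPolynomial Literature.Computability.AlgebraicComplexity Literature.Computability.Complexity
open ArithCircuit KIReduction

/-! ### Plumbing: the renamed generic permanent -/

section Plumbing

variable {R : Type*} [CommRing R]

/-- `rename finProdFinEquiv Per_k` has total degree `≤ k`. [folklore] -/
private theorem totalDegree_rename_perPoly_le (k : ℕ) :
    (rename finProdFinEquiv (perPoly (Fin k) R) : MvPolynomial (Fin (k * k)) R).totalDegree ≤ k := by
  refine (totalDegree_rename_le _ _).trans ?_
  have h := (perPoly_isHomogeneous (n := Fin k) (k := R)).totalDegree_le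
  simpa using h

/-- Over a nontrivial ring every one of the `k·k` variables occurs in `rename finProdFinEquiv Per_k`.
[folklore] -/
private theorem card_vars_rename_perPoly [Nontrivial R] (k : ℕ) :
    (rename finProdFinEquiv (perPoly (Fin k) R) : MvPolynomial (Fin (k * k)) R).vars.card = k * k := by
  have hall : (rename finProdFinEquiv (perPoly (Fin k) R) : MvPolynomial (Fin (k * k)) R).vars =
      Finset.univ := by
    ext j
    simp only [Finset.mem_univ, iff_true]
    have hdeg : degreeOf j (rename finProdFinEquiv (perPoly (Fin k) R) : MvPolynomial (Fin (k * k)) R) = 1 := by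
      obtain ⟨v, rfl⟩ := finProdFinEquiv.surjective j
      rw [degreeOf_rename_of_injective finProdFinEquiv.injective, degreeOf_perPoly]
    rw [mem_vars_iff_degreeOf_ne_zero, hdeg]
    exact one_ne_zero
  rw [hall, Finset.card_univ, Fintype.card_fin]

end Plumbing

/-! ### One level: the witness circuit for `Per_{n+1}` over `𝔽_p` from a complexity bound -/

section Level

variable {p : ℕ} [hp : Fact p.Prime]

/-- **The witness circuit of one level.** If `L_{𝔽_p}(Per_{n+1}) ≤ S` then there is an integer
circuit `C` over `(n+1)·(n+1)` variables — well formed, every gate of fan-in exactly two, formal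
degree `≤ n + 1`, constants in `[0, p)` — computing `Per_{n+1}` modulo `p`
(matrix entry `(a,b)` = variable `finProdFinEquiv (a,b)`), of size `≤ (n+1)² S + (n+1)`, whose code
hosts its variables and has length `≤ 26 (3·size + 1)(size p + size size + size ((n+1)(n+1)) + 6)`
("guess a circuit for `per_k` over `𝔽_p` … encoded as a string", steps 1 and 6).
[cite: BlaserIkenmeyerJindalLysikov2018, §6 (proof of Thm. 5, steps 1 and 6; Thm. 6)] locator: ECCC pp. 18–19 -/
theorem exists_witnessCircuit_of_complexity_le {n S : ℕ}
    (hS : complexity (perPoly (Fin (n + 1)) (ZMod p)) ≤ S) :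
    ∃ C : ArithCircuit ℤ (Fin ((n + 1) * (n + 1))),
      C.WellFormed ∧ (∀ g ∈ C.gates, g.fanIn = 2) ∧ C.formalDegree ≤ n + 1 ∧
      (∀ c ∈ C.consts, 0 ≤ c ∧ c < p) ∧
      MvPolynomial.map (Int.castRingHom (ZMod p)) C.eval =
        rename finProdFinEquiv (perPoly (Fin (n + 1)) (ZMod p)) ∧
      C.size ≤ (n + 1) ^ 2 * S + (n + 1) ∧
      (n + 1) * (n + 1) ≤ (circuitWord ((n + 1) * (n + 1)) C).length ∧
      (circuitWord ((n + 1) * (n + 1)) C).length ≤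
        26 * (3 * ((n + 1) ^ 2 * S + (n + 1)) + 1) *
          (p.size + ((n + 1) ^ 2 * S + (n + 1)).size + ((n + 1) * (n + 1)).size + 6) := by
  set f : MvPolynomial (Fin ((n + 1) * (n + 1))) (ZMod p) :=
    rename finProdFinEquiv (perPoly (Fin (n + 1)) (ZMod p)) with hf
  -- complexity and degree of the renamed permanent
  have hcf : complexity f ≤ S := by
    have h := complexity_renameEquiv_holds (k := ZMod p) finProdFinEquiv (perPoly (Fin (n + 1)) (ZMod p))
    rw [renameEquiv_apply] at h
    rw [hf, h]
    exact hS
  have hdf : f.totalDegree ≤ n + 1 := totalDegree_rename_perPoly_le (R := ZMod p) (n + 1)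
  -- B5: fan-in exactly two, formal degree ≤ n+1
  obtain ⟨P, hfan, h2, hwf, hP, hsize, hdeg⟩ := ArithCircuit.exists_computes_formalDegree_le f hcf hdf
  have hdeg' : P.formalDegree ≤ n + 1 := hdeg.trans (by omega)
  -- B6: the integer lift
  refine ⟨liftZMod P, wellFormed_liftZMod P, forall_fanIn_liftZMod hfan, ?_, consts_liftZMod P, ?_,
    ?_, ?_, ?_⟩
  · rw [formalDegree_liftZMod]; exact hdeg'
  · rw [eval_liftZMod]; exact hP
  · rw [size_liftZMod]
    calc P.size ≤ (n + 1) ^ 2 * S + (n + 1) := hsize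
      _ = (n + 1) ^ 2 * S + (n + 1) := rfl
  · -- the code hosts the variables: every variable occurs in `f`, so `P` has ≥ ((n+1)²-1)/2 gates
    have hvars : f.vars.card ≤ 2 * P.size + 1 := card_vars_le_of_computes h2 hP
    rw [hf, card_vars_rename_perPoly (R := ZMod p) (n + 1)] at hvars
    have hE : (liftZMod P).edgeSize + (liftZMod P).size ≤
        (encodeArithCircuit ((n + 1) * (n + 1)) (liftZMod P)).length :=
      edgeSize_add_size_le_length_encode _ _
    have hedge : (liftZMod P).edgeSize = 2 * P.size := by
      rw [edgeSize_liftZMod, edgeSize]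
      have : P.gates.map Gate.fanIn = P.gates.map (fun _ => 2) := List.map_congr_left hfan
      rw [this]
      simp [size]
      ring
    rw [size_liftZMod] at hE
    rw [circuitWord, length_boolPair]
    omega
  · have h := length_circuitWord_liftZMod_le (m := (n + 1) * (n + 1)) P
    have hedge : P.edgeSize = 2 * P.size := by
      rw [edgeSize]
      have : P.gates.map Gate.fanIn = P.gates.map (fun _ => 2) := List.map_congr_left hfan
      rw [this]
      simp [size]
      ring
    rw [hedge] at h
    refine h.trans ?_
    have hs : P.size ≤ (n + 1) ^ 2 * S + (n + 1) := hsize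
    have hss : P.size.size ≤ ((n + 1) ^ 2 * S + (n + 1)).size := Nat.size_le_size hs
    apply Nat.mul_le_mul
    · nlinarith [hs]
    · omega

/-- **Pointwise form** (what the verifier's modular evaluator is compared against): if
`map (ℤ → 𝔽_p) C.eval = rename finProdFinEquiv Per_{n+1}` then for every integer point `x`,
`C(x) mod p = per ((x (finProdFinEquiv (a,b)) mod p)_{a,b})`.
[cite: BlaserIkenmeyerJindalLysikov2018, §6 (proof of Thm. 5, steps 2–3)] locator: ECCC p. 18 -/
theorem intCast_eval_eq_permanent {n : ℕ} {C : ArithCircuit ℤ (Fin ((n + 1) * (n + 1)))}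
    (hC : MvPolynomial.map (Int.castRingHom (ZMod p)) C.eval =
      rename finProdFinEquiv (perPoly (Fin (n + 1)) (ZMod p)))
    (x : Fin ((n + 1) * (n + 1)) → ℤ) :
    ((MvPolynomial.eval x C.eval : ℤ) : ZMod p) =
      (Matrix.of fun a b : Fin (n + 1) => ((x (finProdFinEquiv (a, b)) : ℤ) : ZMod p)).permanent := by
  have h1 : ((MvPolynomial.eval x C.eval : ℤ) : ZMod p) =
      MvPolynomial.eval (fun i => ((x i : ℤ) : ZMod p)) (MvPolynomial.map (Int.castRingHom (ZMod p)) C.eval) := by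
    rw [MvPolynomial.eval_map]
    change (Int.castRingHom (ZMod p)) (MvPolynomial.eval₂ (RingHom.id ℤ) x C.eval) = _
    rw [MvPolynomial.eval₂_comp_left, RingHom.comp_id]
    rfl
  rw [h1, hC, MvPolynomial.eval_rename, eval_perPoly]
  rfl

/-- **Through the junk-tolerant reader.** The tree's total reading `CircuitCode.semPoly` of a
genuine code word that hosts its variables is the renamed value of the circuit.
[cite: KabanetsImpagliazzo2004, §2] -/
theorem semPoly_circuitWord_eq {m : ℕ} (C : ArithCircuit ℤ (Fin m))
    (h : m ≤ (circuitWord m C).length) :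
    CircuitCode.semPoly (circuitWord m C) =
      rename (Fin.castLE (by rwa [Polynomial.eval_X])) C.eval := by
  have h' : m ≤ Polynomial.X.eval (circuitWord m C).length := by rwa [Polynomial.eval_X]
  rw [CircuitCode.semPoly, CircuitCode.rdCircuit_circuitWord h', eval_rename_apply]

/-- Evaluating the read polynomial of a genuine code word at a point `y` is evaluating the circuit
at the restriction of `y` to the circuit's own variables. [cite: KabanetsImpagliazzo2004, §2] -/
theorem eval_semPoly_circuitWord {m : ℕ} (C : ArithCircuit ℤ (Fin m))
    (h : m ≤ (circuitWord m C).length)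
    (y : Fin (Polynomial.X.eval (circuitWord m C).length) → ℤ) :
    MvPolynomial.eval y (CircuitCode.semPoly (circuitWord m C)) =
      MvPolynomial.eval (fun i => y (Fin.castLE (by rwa [Polynomial.eval_X]) i)) C.eval := by
  rw [semPoly_circuitWord_eq C h, MvPolynomial.eval_rename]
  rfl

/-- The reader sees the formal degree of a genuine code word that hosts its variables.
[cite: KabanetsImpagliazzo2004, §2] -/
theorem formalDegree_rdCircuit_circuitWord {m : ℕ} (C : ArithCircuit ℤ (Fin m))
    (h : m ≤ (circuitWord m C).length) :
    (CircuitCode.rdCircuit (Polynomial.X.eval (circuitWord m C).length) (circuitWord m C)).formalDegree =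
      C.formalDegree := by
  have h' : m ≤ Polynomial.X.eval (circuitWord m C).length := by rwa [Polynomial.eval_X]
  rw [CircuitCode.rdCircuit_circuitWord h', formalDegree_rename]

end Level

/-! ### The family: witness circuits for the `∃·BPP` protocol from the hypothesis of Thm. 6 -/

section Family

/-- Exponent arithmetic: `a ≤ N ^ a` for `N ≥ 2`. [folklore] -/
private theorem self_le_pow {N : ℕ} (hN : 2 ≤ N) (a : ℕ) : a ≤ N ^ a :=
  (Nat.lt_two_pow_self).le.trans (Nat.pow_le_pow_left hN a)

/-- Exponent arithmetic: `N ^ i ≤ N ^ j` for `i ≤ j`, `N ≥ 1`. [folklore] -/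
private theorem pow_mono {N i j : ℕ} (hN : 1 ≤ N) (h : i ≤ j) : N ^ i ≤ N ^ j :=
  Nat.pow_le_pow_right hN h

/-- `size m ≤ m`. [folklore] -/
private theorem size_le_self' (m : ℕ) : m.size ≤ m := Nat.size_le.2 Nat.lt_two_pow_self

/-- Exponent arithmetic: `26 · A · B ≤ N ^ (2F + 6)` from `26 ≤ N³`, `A ≤ N^(F+1)`, `B ≤ N^(F+2)`
(kept as a lemma: stating it inline makes the unifier unfold `Nat.size`). [folklore] -/
private theorem final_bound {N F A B : ℕ} (h26 : 26 ≤ N ^ 3) (hA : A ≤ N ^ (F + 1))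
    (hB : B ≤ N ^ (F + 2)) : 26 * A * B ≤ N ^ (2 * F + 6) :=
  calc 26 * A * B ≤ N ^ 3 * N ^ (F + 1) * N ^ (F + 2) := Nat.mul_le_mul (Nat.mul_le_mul h26 hA) hB
    _ = N ^ (2 * F + 6) := by ring

/-- A p-bounded quantity at `n + 1` is `≤ N ^ (a + 1)` once `n + 1 ≤ N` and `2 ≤ N`. [folklore] -/
private theorem pbound_le_pow {N n a t : ℕ} (hN2 : 2 ≤ N) (hn1 : n + 1 ≤ N) (ht : t ≤ (n + 1) ^ a + a) :
    t ≤ N ^ (a + 1) := by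
  have h1 : (n + 1) ^ a ≤ N ^ a := Nat.pow_le_pow_left hn1 a
  have h2 : a ≤ N ^ a := self_le_pow hN2 a
  have h3 : N ^ a + N ^ a ≤ N ^ (a + 1) := by
    rw [pow_succ, ← mul_two]
    exact Nat.mul_le_mul_left _ hN2
  exact ht.trans ((Nat.add_le_add h1 h2).trans h3)

/-- **Witness circuits for Thm. 6's protocol exist and are short.** From the typed hypothesis of
Thm. 6 (`VP⁰`-natural proofs `D` against `{Per = 0}`) and Kaltofen's theorem over `𝔽_p`
(Thm. 24, the tree's theorem `BIJL2018_thm24_holds`): there is ONE exponent `c` such that for every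
prime `p` and level `n + 1` with `D_{n+1} mod p ≠ 0` and `deg D_{n+1} < p` (the good primes), an
integer circuit over `(n+1)(n+1)` variables exists which is well formed, has all gates of fan-in
exactly two, formal degree `≤ n + 1`, constants in `[0, p)`, computes `Per_{n+1}` modulo `p`, and
has size and code length `≤ ((n + 2)·(log₂ p + 2))^c`, the code hosting its variables — the honest
guess of the `∃·BPP` machine in the proof of Thm. 6 ("guess … circuits for `per_k` over `𝔽_p`,
`k ≤ n`"). [cite: BlaserIkenmeyerJindalLysikov2018, §6 (Thm. 6; proof of Thm. 5, steps 1, 4–6)]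
locator: ECCC pp. 17–19 -/
theorem exists_witnessCircuits (h6 : HasVP0NaturalProofsAgainstPerZero) :
    ∃ (D : ∀ n : ℕ, MvPolynomial (Fin n × Fin n) ℤ) (c : ℕ), IsVP0Family D ∧ (∀ n, D n ≠ 0) ∧
      ∀ (p : ℕ) [Fact p.Prime] (n : ℕ), map (Int.castRingHom (ZMod p)) (D (n + 1)) ≠ 0 →
        (D (n + 1)).totalDegree < p →
        ∃ C : ArithCircuit ℤ (Fin ((n + 1) * (n + 1))),
          C.WellFormed ∧ (∀ g ∈ C.gates, g.fanIn = 2) ∧ C.formalDegree ≤ n + 1 ∧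
          (∀ c ∈ C.consts, 0 ≤ c ∧ c < p) ∧
          MvPolynomial.map (Int.castRingHom (ZMod p)) C.eval =
            rename finProdFinEquiv (perPoly (Fin (n + 1)) (ZMod p)) ∧
          (n + 1) * (n + 1) ≤ (circuitWord ((n + 1) * (n + 1)) C).length ∧
          C.size ≤ ((n + 2) * (Nat.log 2 p + 2)) ^ c ∧
          (circuitWord ((n + 1) * (n + 1)) C).length ≤ ((n + 2) * (Nat.log 2 p + 2)) ^ c := by
  obtain ⟨D, κ, hVP, hD0, hκ⟩ := exists_complexity_perPoly_zmod_le h6 BIJL2018_thm24_holds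
  obtain ⟨a, ha⟩ := hVP.isPBounded_constantFreeComplexity
  obtain ⟨a', ha'⟩ := hVP.isPFamily.2
  -- exponents (kept opaque)
  obtain ⟨E, hE⟩ : ∃ E : ℕ, E = a + a' + 2 := ⟨_, rfl⟩
  obtain ⟨F, hF⟩ : ∃ F : ℕ, F = (E + 1) * κ + E + 4 := ⟨_, rfl⟩
  refine ⟨D, 2 * F + 6, hVP, hD0, fun p _ n hne hdeg => ?_⟩
  have hS := hκ p n hne hdeg
  obtain ⟨S, hSdef⟩ : ∃ S : ℕ, S = ((n + 1) * (n + 1) + constantFreeComplexity (D (n + 1)) +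
      (D (n + 1)).totalDegree + Nat.log 2 p + 2) ^ κ := ⟨_, rfl⟩
  rw [← hSdef] at hS
  obtain ⟨N, hN⟩ : ∃ N : ℕ, N = (n + 2) * (Nat.log 2 p + 2) := ⟨_, rfl⟩
  rw [← hN]
  -- sizes of `N`
  have hN4 : 4 ≤ N := by
    rw [hN]
    exact Nat.mul_le_mul (by omega : 2 ≤ n + 2) (by omega : 2 ≤ Nat.log 2 p + 2)
  have hN1 : 1 ≤ N := by omega
  have hN2 : 2 ≤ N := by omega
  have hn1 : n + 1 ≤ N := by
    rw [hN]
    calc n + 1 ≤ (n + 2) * 1 := by omega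
      _ ≤ (n + 2) * (Nat.log 2 p + 2) := Nat.mul_le_mul_left _ (by omega)
  have hlog : Nat.log 2 p + 2 ≤ N := by
    rw [hN]
    calc Nat.log 2 p + 2 = 1 * (Nat.log 2 p + 2) := (one_mul _).symm
      _ ≤ (n + 2) * (Nat.log 2 p + 2) := Nat.mul_le_mul_right _ (by omega)
  have hNle : ∀ i, 1 ≤ i → N ≤ N ^ i := fun i hi =>
    calc N = N ^ 1 := (pow_one N).symm
      _ ≤ N ^ i := pow_mono hN1 hi
  -- step (c)'s bound `S ≤ N ^ ((E+1) κ)`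
  have hτ : constantFreeComplexity (D (n + 1)) ≤ N ^ E :=
    (pbound_le_pow hN2 hn1 (ha (n + 1))).trans (pow_mono hN1 (by omega))
  have hδ : (D (n + 1)).totalDegree ≤ N ^ E :=
    (pbound_le_pow hN2 hn1 (ha' (n + 1))).trans (pow_mono hN1 (by omega))
  have hsq : (n + 1) * (n + 1) ≤ N ^ E := by
    calc (n + 1) * (n + 1) ≤ N * N := Nat.mul_le_mul hn1 hn1
      _ = N ^ 2 := (sq N).symm
      _ ≤ N ^ E := pow_mono hN1 (by omega)
  have hlg : Nat.log 2 p + 2 ≤ N ^ E := hlog.trans (hNle E (by omega))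
  have hbase : (n + 1) * (n + 1) + constantFreeComplexity (D (n + 1)) + (D (n + 1)).totalDegree +
      Nat.log 2 p + 2 ≤ N ^ (E + 1) := by
    have h4 : 4 * N ^ E ≤ N ^ (E + 1) := by
      rw [pow_succ, mul_comm]
      exact Nat.mul_le_mul_left _ hN4
    calc (n + 1) * (n + 1) + constantFreeComplexity (D (n + 1)) + (D (n + 1)).totalDegree +
          Nat.log 2 p + 2
        ≤ N ^ E + N ^ E + N ^ E + N ^ E := by omega
      _ = 4 * N ^ E := by ring
      _ ≤ N ^ (E + 1) := h4
  have hSle : S ≤ N ^ ((E + 1) * κ) := by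
    rw [hSdef, pow_mul]
    exact Nat.pow_le_pow_left hbase κ
  -- the level witness
  obtain ⟨C, hwf, hfan, hfd, hconst, hmap, hsize, hhost, hlen⟩ :=
    exists_witnessCircuit_of_complexity_le (p := p) (n := n) hS
  -- `size ≤ N ^ F`
  have hsizeF : (n + 1) ^ 2 * S + (n + 1) ≤ N ^ F := by
    have h1 : (n + 1) ^ 2 ≤ N ^ 2 := Nat.pow_le_pow_left hn1 2
    have h2 : (n + 1) ^ 2 * S ≤ N ^ ((E + 1) * κ + 2) := by
      calc (n + 1) ^ 2 * S ≤ N ^ 2 * N ^ ((E + 1) * κ) := Nat.mul_le_mul h1 hSle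
        _ = N ^ ((E + 1) * κ + 2) := by ring
    have h4 : n + 1 ≤ N ^ ((E + 1) * κ + 2) := hn1.trans (hNle _ (by omega))
    have h5 : 2 * N ^ ((E + 1) * κ + 2) ≤ N ^ F := by
      calc 2 * N ^ ((E + 1) * κ + 2) ≤ N * N ^ ((E + 1) * κ + 2) := Nat.mul_le_mul_right _ hN2
        _ = N ^ ((E + 1) * κ + 3) := by ring
        _ ≤ N ^ F := pow_mono hN1 (by omega)
    calc (n + 1) ^ 2 * S + (n + 1) ≤ N ^ ((E + 1) * κ + 2) + N ^ ((E + 1) * κ + 2) :=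
          Nat.add_le_add h2 h4
      _ = 2 * N ^ ((E + 1) * κ + 2) := by ring
      _ ≤ N ^ F := h5
  have hCsize : C.size ≤ N ^ F := hsize.trans hsizeF
  refine ⟨C, hwf, hfan, hfd, hconst, hmap, hhost, hCsize.trans (pow_mono hN1 (by omega)),
    hlen.trans ?_⟩
  -- the code length: `26 · (3 size + 1) · (size p + size size + size m + 6) ≤ N^3 · N^(F+1) · N^(F+2)`
  have hNF1 : 1 ≤ N ^ F := Nat.one_le_pow _ _ hN1
  have hNF : N ≤ N ^ F := hNle F (by omega)
  have hA : 3 * ((n + 1) ^ 2 * S + (n + 1)) + 1 ≤ N ^ (F + 1) := by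
    calc 3 * ((n + 1) ^ 2 * S + (n + 1)) + 1 ≤ 3 * N ^ F + N ^ F :=
          Nat.add_le_add (Nat.mul_le_mul_left 3 hsizeF) hNF1
      _ = 4 * N ^ F := by ring
      _ ≤ N * N ^ F := Nat.mul_le_mul_right _ hN4
      _ = N ^ (F + 1) := by ring
  have hps : p.size ≤ N ^ F := by
    have h1 : p.size ≤ Nat.log 2 p + 1 := by
      rw [← TM2Pass.length_encodeNat_eq_size]; exact TM2Pass.length_encodeNat_le p
    exact (by omega : p.size ≤ Nat.log 2 p + 2).trans (hlog.trans hNF)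
  have hss : ((n + 1) ^ 2 * S + (n + 1)).size ≤ N ^ F := (size_le_self' _).trans hsizeF
  have hms : ((n + 1) * (n + 1)).size ≤ N ^ F :=
    (size_le_self' _).trans (hsq.trans (pow_mono hN1 (by omega)))
  have hB : p.size + ((n + 1) ^ 2 * S + (n + 1)).size + ((n + 1) * (n + 1)).size + 6 ≤
      N ^ (F + 2) := by
    have h5 : 5 ≤ N ^ 2 := by
      calc 5 ≤ 4 * 4 := by norm_num
        _ ≤ N * N := Nat.mul_le_mul hN4 hN4
        _ = N ^ 2 := (sq N).symm
    have h6 : 6 ≤ 2 * N ^ F := by omega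
    calc p.size + ((n + 1) ^ 2 * S + (n + 1)).size + ((n + 1) * (n + 1)).size + 6
        ≤ N ^ F + N ^ F + N ^ F + 2 * N ^ F :=
          Nat.add_le_add (Nat.add_le_add (Nat.add_le_add hps hss) hms) h6
      _ = 5 * N ^ F := by ring
      _ ≤ N ^ 2 * N ^ F := Nat.mul_le_mul_right _ h5
      _ = N ^ (F + 2) := by ring
  have h26 : 26 ≤ N ^ 3 := by
    calc 26 ≤ 4 ^ 3 := by norm_num
      _ ≤ N ^ 3 := Nat.pow_le_pow_left hN4 3
  exact final_bound h26 hA hB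

end Family

end Literature.Barriers.ValiantsHypothesis
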